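import Summits.AtomisticToContinuum.BoseEinsteinCondensation.Theorems.BECThomsonPrinciplePeriodicToDirichletAnchors
import Literature.MathematicalPhysics.QuantumManyBody.BoseGasDiluteEnergyFloor
import Literature.MathematicalPhysics.QuantumManyBody.BoseGasFreeDirichletBEC

/-!
# Route `BECThomsonPrinciple`, crux `PeriodicToDirichlet` (stmt-AtomisticToContinuum-9483),
# line `reward-pays-the-wall` — the RESIDUAL in its weakest, reward-free crux-closing form

What the line extracts from the crux hypothesis `A = PeriodicBEC` on the Dirichlet side is exactly
the **rewarded upper bound** `RewardedUpperBound v ρ (min c 1)` (`stub_transfer`: the padded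
Basti–Cenatiempo–Schlein cut-off state at the SAME density, `A` used once at `(v, ρ)`; landed
stubs `stub_rewardedUpperBound`, `paddedCutoffState_holds`) — and, below the density cap of
`exists_density_cap_tendsto_e0` where `E₀^D(N, L_N)/N → e₀(ρ) < ∞`, that bound is EQUIVALENT to
the reward-free, finite-`N` statement **condensed near-ground states exist**:

  `∀ θ > 0, ∀ᶠ N, ∃ Ψ : TrialState N (L_N ρ), ⟨Ψ,HΨ⟩ ≤ E₀^D(N, L_N ρ) + θN ∧ n_φ(Ψ) ≥ (c - θ) N`

(`eventually_exists_condensed_of_rewardedUpperBound`, `rewardedUpperBound_of_exists_condensed`).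
Nothing else crosses the wall. Hence the crux follows from the single-boundary-condition,
reward-free statement "condensed near-ground states ⟹ ground-state BEC"
(`periodicToDirichlet_of_condensedToBEC`, hypothesis spelled out; it is the registered stub
`stub_condensedToBEC : CondensedToBEC` of the lead's gen-1 skeleton
`Cruxes/PeriodicToDirichlet/Lines/reward_pays_the_wall.lean`), equivalently from "rewarded upper
bound ⟹ BEC" (`periodicToDirichlet_of_upperBoundToBEC`). This residual is

* WEAKER than the planner's `Unrewarding` (`condensedToBEC_of_unrewarding`,
  `upperBoundToBEC_of_unrewarding`: the landed sandwich `stub_rewardSandwich` turns the rewarded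
  upper bound into the anchors `∀ λ > 0` with constant `c/2`, `Unrewarding` removes the reward in
  flat-mode form, the glue `hasGroundStateBEC_of_rewardedBoxBECAt_zero` makes it mode-free);
* MODE-FREE in its conclusion (`HasGroundStateBEC`, what the composition consumes), hence immune
  to the flat-vs-sine mode mismatch that makes `Unrewarding` with `c' = c` false at `v = 0`
  (`Negative/RewardedFreeGasAnchors`); its `v = 0` instance holds outright
  (`condensedToBEC_at_zero`, from the landed `hasGroundStateBEC_zero`);
* of open-problem rank for `v ≠ 0`: it is the inference "flat-condensed trial states within `θN`
  of `E₀^D` for every `θ > 0` ⟹ condensed `δ`-near-minimisers (`δ` after `N`)", which no energy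
  method supplies (barrier `EnergyAsymptoticsWithoutCondensation`; the soft schema is false,
  `Negative/SoftUnrewardingSchema`) — BEC in one Dirichlet cube, costume-free.

References: LSSY 2005 §1.2 (1.17)–(1.19), Ch. 2 after (2.2) and (2.8), App. D (D.15)–(D.19);
Griffiths 1966 §II; Basti–Cenatiempo–Schlein 2021 App. A; Ruelle 1969 §3.5.11.
-/

noncomputable section

open MeasureTheory Filter
open scoped ENNReal NNReal Topology

namespace Summit.AtomisticToContinuum.BoseEinsteinCondensation.RewardPaysTheWall

open Literature.MathematicalPhysics.QuantumManyBody.BoseGas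

/-! ## The transfer (registered stub `stub_transfer`, proved) -/

/-- **The transfer theorem of the line** (registered stub `stub_transfer`; sorry-free over the
landed stubs): for every repulsive finite-range `v` there is `ρ₁ > 0` such that for `0 < ρ < ρ₁`
and every `c > 0`, torus BEC of the genuine periodic near-minimisers with constant `c` at density
`ρ` (`TorusBECAt v ρ c`, the body of the crux hypothesis) gives the rewarded upper bound in the
Dirichlet box of side exactly `L_N(ρ)` with constant `min c 1`:
`∀ θ > 0, ∀ λ ≥ 0, ∀ᶠ N, F^D(λ) ≤ N (e₀ + θ + λ (1 - min c 1 + θ))`. [folklore] -/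
theorem stub_transfer :
    ∀ v : ℝ → ℝ≥0∞, IsRepulsiveFiniteRange v → ∃ ρ₁ : ℝ, 0 < ρ₁ ∧ ∀ ρ : ℝ, 0 < ρ → ρ < ρ₁ →
      ∀ c : ℝ, 0 < c → TorusBECAt v ρ c → RewardedUpperBound v ρ (min c 1) := by
  intro v hv
  obtain ⟨ρ₁, hρ₁, H2⟩ := stub_rewardedUpperBound paddedCutoffState_holds v hv
  refine ⟨ρ₁, hρ₁, fun ρ hρ hlt c hc hT => ?_⟩
  exact H2 ρ hρ hlt (min c 1) (lt_min hc one_pos) (min_le_right c 1)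
    (TorusBECAt.mono (min_le_left c 1) hT)

/-! ## Rewarded upper bound ⟺ condensed near-ground states (below the density cap) -/

/-- Upper half of the Dirichlet thermodynamic limit in the form used here: if `E₀^D(N, L_N)/N → e`
with `e < ∞` then eventually `E₀^D(N, L_N) ≤ (e + ε) N`. [folklore] -/
theorem eventually_groundStateEnergy_le_of_tendsto {v : ℝ → ℝ≥0∞} {ρ : ℝ} {e : ℝ≥0∞}
    (he : e ≠ ⊤) (hT : Tendsto (energyPerParticleDirichlet v ρ) atTop (𝓝 e)) {ε : ℝ}
    (hε : 0 < ε) :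
    ∀ᶠ N : ℕ in atTop,
      groundStateEnergy v N (sideLength ρ N) ≤ ENNReal.ofReal ((e.toReal + ε) * N) := by
  have h0 : 0 ≤ e.toReal + ε := add_nonneg ENNReal.toReal_nonneg hε.le
  have hlt : e < ENNReal.ofReal (e.toReal + ε) := by
    conv_lhs => rw [← ENNReal.ofReal_toReal he]
    exact (ENNReal.ofReal_lt_ofReal_iff (by linarith [ENNReal.toReal_nonneg (a := e)])).2
      (by linarith)
  filter_upwards [(tendsto_order.1 hT).2 _ hlt] with N hN
  have h := (ENNReal.div_le_iff_le_mul (Or.inr ENNReal.ofReal_ne_top)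
    (Or.inl (ENNReal.natCast_ne_top N))).1 hN.le
  calc groundStateEnergy v N (sideLength ρ N) ≤ ENNReal.ofReal (e.toReal + ε) * N := h
    _ = ENNReal.ofReal ((e.toReal + ε) * N) := by
        rw [ENNReal.ofReal_mul h0, ENNReal.ofReal_natCast]

/-- `ℝ≥0∞` bookkeeping: a lower bound `ofReal y ≤ a` gives `n - a ≤ ofReal (n - y)`. [folklore] -/
theorem natCast_tsub_le_ofReal_sub {n : ℕ} {y : ℝ} {a : ℝ≥0∞} (h : ENNReal.ofReal y ≤ a) :
    (n : ℝ≥0∞) - a ≤ ENNReal.ofReal (n - y) := by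
  rw [tsub_le_iff_right]
  calc (n : ℝ≥0∞) = ENNReal.ofReal ((n - y) + y) := by rw [sub_add_cancel, ENNReal.ofReal_natCast]
    _ ≤ ENNReal.ofReal (n - y) + ENNReal.ofReal y := ENNReal.ofReal_add_le
    _ ≤ ENNReal.ofReal (n - y) + a := add_le_add le_rfl h

/-- **Condensed near-ground states give the rewarded upper bound** (the easy direction; needs
only the upper half `E₀^D ≤ N(e₀ + ε)` of the Dirichlet limit): if for every `θ > 0`, eventually,
some Dirichlet trial state within `θN` of `E₀^D(N, L_N)` has flat occupation `≥ (c - θ)N`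
(`c ≤ 1`), then `RewardedUpperBound v ρ c` — evaluate `R_λ` on that state:
`F^D(λ) ≤ E₀^D + θN + λ N (1 - c + θ) ≤ N (e₀ + 2θ + λ(1 - c + θ))`. [folklore] -/
theorem rewardedUpperBound_of_exists_condensed {v : ℝ → ℝ≥0∞} {ρ c : ℝ} (he : e0 v ρ ≠ ⊤)
    (hT : Tendsto (energyPerParticleDirichlet v ρ) atTop (𝓝 (e0 v ρ))) (hc1 : c ≤ 1)
    (hC : ∀ θ : ℝ, 0 < θ → ∀ᶠ N : ℕ in atTop, ∃ Ψ : TrialState N (sideLength ρ N),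
      energy v Ψ ≤ groundStateEnergy v N (sideLength ρ N) + ENNReal.ofReal (θ * N) ∧
        ENNReal.ofReal ((c - θ) * N) ≤ occupation N (boxConstantMode (sideLength ρ N)) Ψ.ψ) :
    RewardedUpperBound v ρ c := by
  intro θ₀ hθ₀ lam hlam
  have hθ : 0 < θ₀ / 2 := half_pos hθ₀
  have he0 : 0 ≤ (e0 v ρ).toReal := ENNReal.toReal_nonneg
  filter_upwards [hC (θ₀ / 2) hθ, eventually_groundStateEnergy_le_of_tendsto he hT hθ]
    with N hΨ hE0
  obtain ⟨Ψ, hE, hocc⟩ := hΨ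
  have hN : (0 : ℝ) ≤ N := N.cast_nonneg
  have h1c : 0 ≤ 1 - c + θ₀ / 2 := by linarith
  calc rewardedInf v lam N (sideLength ρ N) ≤ rewardedEnergy v lam Ψ := rewardedInf_le v lam Ψ
    _ = energy v Ψ + ENNReal.ofReal lam *
          ((N : ℝ≥0∞) - occupation N (boxConstantMode (sideLength ρ N)) Ψ.ψ) := rfl
    _ ≤ (ENNReal.ofReal (((e0 v ρ).toReal + θ₀ / 2) * N) + ENNReal.ofReal (θ₀ / 2 * N)) +
          ENNReal.ofReal lam * ENNReal.ofReal (N - (c - θ₀ / 2) * N) := by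
        gcongr
        · exact hE.trans (add_le_add hE0 le_rfl)
        · exact natCast_tsub_le_ofReal_sub hocc
    _ = ENNReal.ofReal (((e0 v ρ).toReal + θ₀ / 2) * N + θ₀ / 2 * N +
          lam * (N - (c - θ₀ / 2) * N)) := by
        rw [← ENNReal.ofReal_add (by positivity) (by positivity), ← ENNReal.ofReal_mul hlam,
          ← ENNReal.ofReal_add (by positivity)]
        exact mul_nonneg hlam (by nlinarith)
    _ ≤ ENNReal.ofReal (N * ((e0 v ρ).toReal + θ₀ + lam * (1 - c + θ₀))) := by
        refine ENNReal.ofReal_le_ofReal ?_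
        have : lam * (N - (c - θ₀ / 2) * N) ≤ lam * (N * (1 - c + θ₀)) :=
          mul_le_mul_of_nonneg_left (by nlinarith) hlam
        nlinarith

/-- **The rewarded upper bound gives condensed near-ground states** (the direction the crux
needs; uses the lower half `E₀^D ≥ N(e₀ - ε)` of the Dirichlet limit, i.e. Griffiths' sandwich
once, at a reward `λ ≍ θ`): if `RewardedUpperBound v ρ c` (`0 < c ≤ 1`) then for every `θ > 0`,
eventually in `N`, some Dirichlet trial state `Ψ` has `⟨Ψ,HΨ⟩ ≤ E₀^D(N, L_N) + θN` and
`n_φ(Ψ) ≥ (c - θ)N`. Proof for `θ ≤ 1` (then monotonicity): with `λ = θ/4`, `t = ε = θ²/16`,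
take `Ψ` within `εN` of `F^D(λ) < ∞`; then `⟨Ψ,HΨ⟩ ≤ R_λ(Ψ) ≤ N(e₀ + t + λ(1 - c + t)) + εN ≤
E₀^D + N(2ε + t + λ(1 + t)) ≤ E₀^D + θN`, and `λ(N - n_φ) ≤ R_λ(Ψ) - E₀^D ≤ N(t + 2ε + λ(1 - c + t))`
gives `n_φ ≥ N(c - t - (t + 2ε)/λ) ≥ (c - θ)N`. [folklore] -/
theorem eventually_exists_condensed_of_rewardedUpperBound {v : ℝ → ℝ≥0∞} {ρ c : ℝ}
    (he : e0 v ρ ≠ ⊤) (hT : Tendsto (energyPerParticleDirichlet v ρ) atTop (𝓝 (e0 v ρ)))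
    (hc : 0 < c) (hc1 : c ≤ 1) (hU : RewardedUpperBound v ρ c) {θ : ℝ} (hθ : 0 < θ) :
    ∀ᶠ N : ℕ in atTop, ∃ Ψ : TrialState N (sideLength ρ N),
      energy v Ψ ≤ groundStateEnergy v N (sideLength ρ N) + ENNReal.ofReal (θ * N) ∧
        ENNReal.ofReal ((c - θ) * N) ≤ occupation N (boxConstantMode (sideLength ρ N)) Ψ.ψ := by
  -- reduce to `θ ≤ 1`
  suffices H : ∀ θ : ℝ, 0 < θ → θ ≤ 1 → ∀ᶠ N : ℕ in atTop, ∃ Ψ : TrialState N (sideLength ρ N),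
      energy v Ψ ≤ groundStateEnergy v N (sideLength ρ N) + ENNReal.ofReal (θ * N) ∧
        ENNReal.ofReal ((c - θ) * N) ≤ occupation N (boxConstantMode (sideLength ρ N)) Ψ.ψ by
    refine (H (min θ 1) (lt_min hθ one_pos) (min_le_right _ _)).mono fun N ⟨Ψ, hE, hocc⟩ => ?_
    refine ⟨Ψ, hE.trans (add_le_add le_rfl (ENNReal.ofReal_le_ofReal
      (mul_le_mul_of_nonneg_right (min_le_left _ _) N.cast_nonneg))), le_trans ?_ hocc⟩
    exact ENNReal.ofReal_le_ofReal (mul_le_mul_of_nonneg_right (by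
      linarith [min_le_left θ 1]) N.cast_nonneg)
  intro θ hθ hθ1
  -- constants
  set lam : ℝ := θ / 4 with hlam
  set t : ℝ := θ ^ 2 / 16 with ht
  have hlam0 : 0 < lam := by rw [hlam]; positivity
  have ht0 : 0 < t := by rw [ht]; positivity
  have he0 : 0 ≤ (e0 v ρ).toReal := ENNReal.toReal_nonneg
  filter_upwards [hU t ht0 lam hlam0.le,
    eventually_mul_sub_le_toReal_of_groundStateEnergy_le he hT ht0, eventually_gt_atTop 0]
    with N hUN hfloor hN0
  have hN : (0 : ℝ) < N := Nat.cast_pos.2 hN0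
  set L := sideLength ρ N with hL
  set A : ℝ := N * ((e0 v ρ).toReal + t + lam * (1 - c + t)) with hA
  have hA0 : 0 ≤ A := by
    have : 0 ≤ lam * (1 - c + t) := mul_nonneg hlam0.le (by linarith)
    rw [hA]; positivity
  -- a near-minimiser of `R_λ` within `tN`
  have hFtop : rewardedInf v lam N L ≠ ⊤ := ne_top_of_le_ne_top ENNReal.ofReal_ne_top hUN
  have hslack : (0 : ℝ≥0∞) < ENNReal.ofReal (t * N) := ENNReal.ofReal_pos.2 (by positivity)
  obtain ⟨Ψ, hΨ⟩ := iInf_lt_iff.mp (ENNReal.lt_add_right hFtop hslack.ne')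
  have hup : energy v Ψ + ENNReal.ofReal lam * ((N : ℝ≥0∞) - occupation N (boxConstantMode L) Ψ.ψ) ≤
      ENNReal.ofReal (A + t * N) :=
    calc energy v Ψ + ENNReal.ofReal lam * ((N : ℝ≥0∞) - occupation N (boxConstantMode L) Ψ.ψ)
        = rewardedEnergy v lam Ψ := rfl
      _ ≤ rewardedInf v lam N L + ENNReal.ofReal (t * N) := hΨ.le
      _ ≤ ENNReal.ofReal A + ENNReal.ofReal (t * N) := add_le_add hUN le_rfl
      _ = ENNReal.ofReal (A + t * N) := (ENNReal.ofReal_add hA0 (by positivity)).symm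
  have htop : energy v Ψ + ENNReal.ofReal lam *
      ((N : ℝ≥0∞) - occupation N (boxConstantMode L) Ψ.ψ) ≠ ⊤ :=
    ne_top_of_le_ne_top ENNReal.ofReal_ne_top hup
  have hEtop : energy v Ψ ≠ ⊤ := (ENNReal.add_ne_top.1 htop).1
  have hRtop : ENNReal.ofReal lam * ((N : ℝ≥0∞) - occupation N (boxConstantMode L) Ψ.ψ) ≠ ⊤ :=
    (ENNReal.add_ne_top.1 htop).2
  have hE0top : groundStateEnergy v N L ≠ ⊤ :=
    ne_top_of_le_ne_top hEtop (groundStateEnergy_le_energy v Ψ)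
  -- the floor, for `E₀^D` and for `⟨Ψ,HΨ⟩`
  have hfloorE0 : (N : ℝ) * ((e0 v ρ).toReal - t) ≤ (groundStateEnergy v N L).toReal :=
    hfloor _ le_rfl hE0top
  have hE0E : (groundStateEnergy v N L).toReal ≤ (energy v Ψ).toReal :=
    ENNReal.toReal_mono hEtop (groundStateEnergy_le_energy v Ψ)
  refine ⟨Ψ, ?_, ?_⟩
  · -- energy: `⟨Ψ,HΨ⟩ ≤ E₀^D + θN`
    have hEr : (energy v Ψ).toReal ≤ A + t * N := by
      have h := ENNReal.toReal_mono ENNReal.ofReal_ne_top ((le_self_add).trans hup)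
      rwa [ENNReal.toReal_ofReal (by positivity)] at h
    have hkey : (energy v Ψ).toReal ≤ (groundStateEnergy v N L).toReal + θ * N := by
      have h1 : lam * (1 - c + t) ≤ lam * (1 + t) := mul_le_mul_of_nonneg_left (by linarith) hlam0.le
      have h2 : 2 * t + t + lam * (1 + t) ≤ θ := by
        rw [ht, hlam]; nlinarith
      rw [hA] at hEr
      nlinarith
    calc energy v Ψ = ENNReal.ofReal (energy v Ψ).toReal := (ENNReal.ofReal_toReal hEtop).symm
      _ ≤ ENNReal.ofReal ((groundStateEnergy v N L).toReal + θ * N) := ENNReal.ofReal_le_ofReal hkey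
      _ = ENNReal.ofReal (groundStateEnergy v N L).toReal + ENNReal.ofReal (θ * N) :=
          ENNReal.ofReal_add ENNReal.toReal_nonneg (by positivity)
      _ = groundStateEnergy v N L + ENNReal.ofReal (θ * N) := by rw [ENNReal.ofReal_toReal hE0top]
  · -- occupation: `n_φ ≥ (c - θ)N`
    rcases le_or_gt (N : ℝ≥0∞) (occupation N (boxConstantMode L) Ψ.ψ) with hNn | hnN
    · calc ENNReal.ofReal ((c - θ) * N) ≤ ENNReal.ofReal (N : ℝ) :=
            ENNReal.ofReal_le_ofReal (by nlinarith)
        _ = (N : ℝ≥0∞) := ENNReal.ofReal_natCast N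
        _ ≤ _ := hNn
    have hn_top : occupation N (boxConstantMode L) Ψ.ψ ≠ ⊤ := hnN.ne_top
    have hsub : ((N : ℝ≥0∞) - occupation N (boxConstantMode L) Ψ.ψ).toReal =
        N - (occupation N (boxConstantMode L) Ψ.ψ).toReal := by
      rw [ENNReal.toReal_sub_of_le hnN.le (ENNReal.natCast_ne_top N), ENNReal.toReal_natCast]
    have hup' : (energy v Ψ).toReal + lam * (N - (occupation N (boxConstantMode L) Ψ.ψ).toReal) ≤
        A + t * N := by
      have h := ENNReal.toReal_mono ENNReal.ofReal_ne_top hup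
      rwa [ENNReal.toReal_add hEtop hRtop, ENNReal.toReal_mul, ENNReal.toReal_ofReal hlam0.le, hsub,
        ENNReal.toReal_ofReal (by positivity)] at h
    have hkey : lam * ((c - θ) * N) ≤ lam * (occupation N (boxConstantMode L) Ψ.ψ).toReal := by
      have h2 : t + (t + 2 * t) / lam ≤ θ := by
        rw [ht, hlam]
        have : (θ ^ 2 / 16 + 2 * (θ ^ 2 / 16)) / (θ / 4) = 3 * θ / 4 := by
          field_simp; ring
        rw [this]; nlinarith
      have h3 : lam * (t + (t + 2 * t) / lam) = lam * t + (t + 2 * t) := by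
        field_simp
      rw [hA] at hup'
      nlinarith [mul_le_mul_of_nonneg_left h2 (by positivity : (0 : ℝ) ≤ lam * N)]
    calc ENNReal.ofReal ((c - θ) * N)
        ≤ ENNReal.ofReal (occupation N (boxConstantMode L) Ψ.ψ).toReal :=
          ENNReal.ofReal_le_ofReal (le_of_mul_le_mul_left hkey hlam0)
      _ = _ := ENNReal.ofReal_toReal hn_top

/-! ## The crux from the reward-free residual -/

/-- **The crux from the residual "condensed near-ground states ⟹ BEC"** (hypothesis spelled
out; it is the registered stub `stub_condensedToBEC` of the gen-1 skeleton). Given `A` and an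
admissible `v`: `A` gives `ρ_A` and, for `ρ < ρ_A`, a constant `c(ρ) > 0` with `TorusBECAt v ρ c`
(definitional unfolding); `stub_transfer` gives `RewardedUpperBound v ρ (min c 1)` for `ρ < ρ₁`;
below the cap `ρ₂` of `exists_density_cap_tendsto_e0` this yields condensed near-ground states
(`eventually_exists_condensed_of_rewardedUpperBound`); the residual gives `HasGroundStateBEC v ρ`
for `ρ < ρ₄`; so the conjunct holds with `ρ₀ = min (ρ_A, ρ₁, ρ₂, ρ₄)`. [folklore] -/
theorem periodicToDirichlet_of_condensedToBEC
    (h : ∀ v : ℝ → ℝ≥0∞, IsRepulsiveFiniteRange v → ∃ ρ₄ : ℝ, 0 < ρ₄ ∧ ∀ ρ : ℝ, 0 < ρ → ρ < ρ₄ →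
      ∀ c : ℝ, 0 < c → c ≤ 1 →
        (∀ θ : ℝ, 0 < θ → ∀ᶠ N : ℕ in atTop, ∃ Ψ : TrialState N (sideLength ρ N),
          energy v Ψ ≤ groundStateEnergy v N (sideLength ρ N) + ENNReal.ofReal (θ * N) ∧
            ENNReal.ofReal ((c - θ) * N) ≤ occupation N (boxConstantMode (sideLength ρ N)) Ψ.ψ) →
        HasGroundStateBEC v ρ) :
    Summit.AtomisticToContinuum.BoseEinsteinCondensation.Theses.BECThomsonPrinciple.PeriodicToDirichlet := by
  intro hA v hv
  obtain ⟨ρA, hρA, HA⟩ := hA v hv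
  obtain ⟨ρ₁, hρ₁, H1⟩ := stub_transfer v hv
  obtain ⟨ρ₂, hρ₂, H2⟩ := exists_density_cap_tendsto_e0 v hv
  obtain ⟨ρ₄, hρ₄, H4⟩ := h v hv
  refine ⟨min (min ρA ρ₁) (min ρ₂ ρ₄), lt_min (lt_min hρA hρ₁) (lt_min hρ₂ hρ₄),
    fun ρ hρ hlt => ?_⟩
  obtain ⟨c, hc, hT⟩ := HA ρ hρ (hlt.trans_le ((min_le_left _ _).trans (min_le_left _ _)))
  obtain ⟨he, hTD, -⟩ := H2 ρ hρ (hlt.trans_le ((min_le_right _ _).trans (min_le_left _ _)))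
  have hU : RewardedUpperBound v ρ (min c 1) :=
    H1 ρ hρ (hlt.trans_le ((min_le_left _ _).trans (min_le_right _ _))) c hc hT
  exact H4 ρ hρ (hlt.trans_le ((min_le_right _ _).trans (min_le_right _ _))) (min c 1)
    (lt_min hc one_pos) (min_le_right c 1)
    (fun θ hθ => eventually_exists_condensed_of_rewardedUpperBound he hTD (lt_min hc one_pos)
      (min_le_right c 1) hU hθ)

/-- **The crux from the residual "rewarded upper bound ⟹ BEC"** (the same residual in the
line's own vocabulary; hypothesis spelled out). [folklore] -/
theorem periodicToDirichlet_of_upperBoundToBEC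
    (h : ∀ v : ℝ → ℝ≥0∞, IsRepulsiveFiniteRange v → ∃ ρ₄ : ℝ, 0 < ρ₄ ∧ ∀ ρ : ℝ, 0 < ρ → ρ < ρ₄ →
      ∀ c : ℝ, 0 < c → c ≤ 1 → RewardedUpperBound v ρ c → HasGroundStateBEC v ρ) :
    Summit.AtomisticToContinuum.BoseEinsteinCondensation.Theses.BECThomsonPrinciple.PeriodicToDirichlet := by
  intro hA v hv
  obtain ⟨ρA, hρA, HA⟩ := hA v hv
  obtain ⟨ρ₁, hρ₁, H1⟩ := stub_transfer v hv
  obtain ⟨ρ₄, hρ₄, H4⟩ := h v hv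
  refine ⟨min ρA (min ρ₁ ρ₄), lt_min hρA (lt_min hρ₁ hρ₄), fun ρ hρ hlt => ?_⟩
  obtain ⟨c, hc, hT⟩ := HA ρ hρ (hlt.trans_le (min_le_left _ _))
  exact H4 ρ hρ (hlt.trans_le ((min_le_right _ _).trans (min_le_right _ _))) (min c 1)
    (lt_min hc one_pos) (min_le_right c 1)
    (H1 ρ hρ (hlt.trans_le ((min_le_right _ _).trans (min_le_left _ _))) c hc hT)

/-! ## The residual is weaker than the planner's `Unrewarding`, and holds at `v = 0` -/

/-- `Unrewarding` implies "rewarded upper bound ⟹ BEC": the landed sandwich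
(`stub_rewardSandwich`) turns `RewardedUpperBound v ρ c` (`0 < c ≤ 1`, `ρ < ρ₂`) into the
anchors `∀ λ > 0, RewardedBoxBECAt v ρ λ (c/2)`; `Unrewarding` removes the reward (`ρ < ρ₃`); the
glue `hasGroundStateBEC_of_rewardedBoxBECAt_zero` makes the conclusion mode-free. [folklore] -/
theorem upperBoundToBEC_of_unrewarding (h : Unrewarding) :
    ∀ v : ℝ → ℝ≥0∞, IsRepulsiveFiniteRange v → ∃ ρ₄ : ℝ, 0 < ρ₄ ∧ ∀ ρ : ℝ, 0 < ρ → ρ < ρ₄ →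
      ∀ c : ℝ, 0 < c → c ≤ 1 → RewardedUpperBound v ρ c → HasGroundStateBEC v ρ := by
  intro v hv
  obtain ⟨ρ₂, hρ₂, H3⟩ := stub_rewardSandwich v hv
  obtain ⟨ρ₃, hρ₃, H4⟩ := h v hv
  refine ⟨min ρ₂ ρ₃, lt_min hρ₂ hρ₃, fun ρ hρ hlt c hc hc1 hU => ?_⟩
  obtain ⟨c', hc', h0⟩ := H4 ρ hρ (hlt.trans_le (min_le_right _ _)) (c / 2) (half_pos hc)
    (H3 ρ hρ (hlt.trans_le (min_le_left _ _)) c hc hc1 hU)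
  exact hasGroundStateBEC_of_rewardedBoxBECAt_zero hρ hc' h0

/-- `Unrewarding` implies "condensed near-ground states ⟹ BEC" (via
`rewardedUpperBound_of_exists_condensed` below the density cap, then the previous lemma).
[folklore] -/
theorem condensedToBEC_of_unrewarding (h : Unrewarding) :
    ∀ v : ℝ → ℝ≥0∞, IsRepulsiveFiniteRange v → ∃ ρ₄ : ℝ, 0 < ρ₄ ∧ ∀ ρ : ℝ, 0 < ρ → ρ < ρ₄ →
      ∀ c : ℝ, 0 < c → c ≤ 1 →
        (∀ θ : ℝ, 0 < θ → ∀ᶠ N : ℕ in atTop, ∃ Ψ : TrialState N (sideLength ρ N),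
          energy v Ψ ≤ groundStateEnergy v N (sideLength ρ N) + ENNReal.ofReal (θ * N) ∧
            ENNReal.ofReal ((c - θ) * N) ≤ occupation N (boxConstantMode (sideLength ρ N)) Ψ.ψ) →
        HasGroundStateBEC v ρ := by
  intro v hv
  obtain ⟨ρ₂, hρ₂, H2⟩ := exists_density_cap_tendsto_e0 v hv
  obtain ⟨ρ₅, hρ₅, H5⟩ := upperBoundToBEC_of_unrewarding h v hv
  refine ⟨min ρ₂ ρ₅, lt_min hρ₂ hρ₅, fun ρ hρ hlt c hc hc1 hC => ?_⟩
  obtain ⟨he, hTD, -⟩ := H2 ρ hρ (hlt.trans_le (min_le_left _ _))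
  exact H5 ρ hρ (hlt.trans_le (min_le_right _ _)) c hc hc1
    (rewardedUpperBound_of_exists_condensed he hTD hc1 hC)

/-- **The `v = 0` instance of the residual holds outright** (its conclusion does, by the landed
free Dirichlet BEC `hasGroundStateBEC_zero`; whereas the flat-mode `Unrewarding` at `v = 0`
cannot keep its constant, `Negative/RewardedFreeGasAnchors`). [folklore] -/
theorem condensedToBEC_at_zero :
    ∃ ρ₄ : ℝ, 0 < ρ₄ ∧ ∀ ρ : ℝ, 0 < ρ → ρ < ρ₄ → ∀ c : ℝ, 0 < c → c ≤ 1 →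
      (∀ θ : ℝ, 0 < θ → ∀ᶠ N : ℕ in atTop, ∃ Ψ : TrialState N (sideLength ρ N),
        energy 0 Ψ ≤ groundStateEnergy 0 N (sideLength ρ N) + ENNReal.ofReal (θ * N) ∧
          ENNReal.ofReal ((c - θ) * N) ≤ occupation N (boxConstantMode (sideLength ρ N)) Ψ.ψ) →
      HasGroundStateBEC 0 ρ :=
  ⟨1, one_pos, fun _ hρ _ _ _ _ _ => hasGroundStateBEC_zero hρ⟩

/-- … and so does the `v = 0` instance of "rewarded upper bound ⟹ BEC". [folklore] -/
theorem upperBoundToBEC_at_zero :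
    ∃ ρ₄ : ℝ, 0 < ρ₄ ∧ ∀ ρ : ℝ, 0 < ρ → ρ < ρ₄ →
      ∀ c : ℝ, 0 < c → c ≤ 1 → RewardedUpperBound 0 ρ c → HasGroundStateBEC 0 ρ :=
  ⟨1, one_pos, fun _ hρ _ _ _ _ _ => hasGroundStateBEC_zero hρ⟩

end Summit.AtomisticToContinuum.BoseEinsteinCondensation.RewardPaysTheWall

end
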